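import Summits.AtomisticToContinuum.Crystallization.Theorems.FreeSplittingCertificatesStrictSplittingRuleTorusModelDualSum

/-!
# Table transfers of the torus model sum to zero over the sites (structural theorem) — dual corollaries in the primal's own format

Route `FreeSplittingCertificates`, crux `StrictSplittingRule` (stmt-AtomisticToContinuum-12560); unit b2b-freesplit-B (block 2b,
PART B, gen 2).  **VALUE = theorems about a FINITE model — NOT summit progress.**

The primal certificates (`…TorusModel442Defs`, `…TorusModelGen`, `…TorusModel552`) place, for every pair class `(b, d, bq, X)`, the
table `+X(dl(p), dl(p+d))` at first sites (parity `b`) and `−X(dl(p−d), dl(p))` at partners (parity `bq`): `transferTermsG p tcls`.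
For the landed 4×4×2 tables `Σ_p T_p = 0` was CHECKED (`transfer_sum_zero`, a Gram-matrix computation).  Here it is PROVED for every
class list on every torus with an even number of layers, under the only hypothesis the data format needs — CONSISTENCY of each class:
the partner parity `bq` is the first parity `b` flipped iff the layer offset `d.k` is odd (hypothesis `hwf`; true for the landed
data by construction).  Ingredients: torus arithmetic (`taddG p d` is a bijection with inverse `taddG · (negOff d)`, `parityG (taddG p d)`), the
value of the transfer terms of one class (`evalQ_transferTermsG`), and reindexing the partner sum by the shift.  Consequently the weak
duality of `…TorusModelDualSum` applies to the certificate's own transfer format with ARBITRARY tables: `not_jointLMI_tables_of_siteSum_neg`.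
[folklore]
-/

namespace Summit.AtomisticToContinuum.Crystallization.Theorems.StrictSplittingRuleTorusLMI

open Literature.Computation.Certificates

/-! ### Torus arithmetic -/

/-- The value of `zmodG N z` is `z mod N`. [folklore] -/
theorem zmodG_val_cast (N : ℕ) [NeZero N] (z : ℤ) : ((zmodG N z).val : ℤ) = z % N := by
  have hN : (0 : ℤ) < N := by exact_mod_cast Nat.pos_of_ne_zero (NeZero.ne N)
  have h0 : 0 ≤ z % N := Int.emod_nonneg _ (ne_of_gt hN)
  have h1 : z % N < N := Int.emod_lt_of_pos _ hN
  have h2 : (z % ↑N).toNat < N := (Int.toNat_lt' (Nat.pos_of_ne_zero (NeZero.ne N))).mpr h1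
  simp only [zmodG, Fin.ofNat, Nat.mod_eq_of_lt h2]
  exact Int.toNat_of_nonneg h0

section Shape

variable (NK N1 : ℕ) [NeZero NK] [NeZero N1]

/-- `zmodG N (v + a + b) = zmodG N (w)` whenever … ; the key step: `zmodG N ((zmodG N (v + a)).val + b) = zmodG N (v + a + b)`. [folklore] -/
theorem zmodG_zmodG_add (N : ℕ) [NeZero N] (z b : ℤ) : zmodG N ((zmodG N z).val + b) = zmodG N (z + b) := by
  apply Fin.ext
  have h := zmodG_val_cast N z
  have e1 := zmodG_val_cast N ((zmodG N z).val + b)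
  have e2 := zmodG_val_cast N (z + b)
  have : (((zmodG N ((zmodG N z).val + b)).val : ℕ) : ℤ) = ((zmodG N (z + b)).val : ℤ) := by
    rw [e1, e2, h, Int.emod_add_emod]
  exact_mod_cast this

/-- `zmodG N (p.val + 0)`-type identity: `zmodG N (i.val) = i` for `i : Fin N`. [folklore] -/
theorem zmodG_val_self (N : ℕ) [NeZero N] (i : Fin N) : zmodG N (i.val : ℤ) = i := by
  apply Fin.ext
  have e := zmodG_val_cast N (i.val : ℤ)
  have : ((i.val : ℤ)) % N = i.val := Int.emod_eq_of_lt (by positivity) (by exact_mod_cast i.isLt)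
  rw [this] at e
  exact_mod_cast e

/-- Shifting by `d` and then by `−d` is the identity. [folklore] -/
theorem taddG_negOff (p : SiteG NK N1) (d : Off) : taddG NK N1 (taddG NK N1 p d) (negOff d) = p := by
  obtain ⟨k, i, j⟩ := p
  obtain ⟨dk, di, dj⟩ := d
  simp only [taddG, negOff, zmodG_zmodG_add, add_neg_cancel_right, zmodG_val_self]

/-- Shifting by `−d` and then by `d` is the identity. [folklore] -/
theorem negOff_taddG (p : SiteG NK N1) (d : Off) : taddG NK N1 (taddG NK N1 p (negOff d)) d = p := by
  obtain ⟨k, i, j⟩ := p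
  obtain ⟨dk, di, dj⟩ := d
  simp only [taddG, negOff, zmodG_zmodG_add, neg_add_cancel_right, zmodG_val_self]

/-- The shift by `d` as a permutation of the torus. [folklore] -/
def shiftEquiv (d : Off) : SiteG NK N1 ≃ SiteG NK N1 where
  toFun p := taddG NK N1 p d
  invFun p := taddG NK N1 p (negOff d)
  left_inv p := taddG_negOff NK N1 p d
  right_inv p := negOff_taddG NK N1 p d

/-- Parity after a shift (even number of layers): flipped iff the layer offset is odd. [folklore] -/
theorem parityG_taddG (hNK : 2 ∣ NK) (p : SiteG NK N1) (d : Off) :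
    parityG NK N1 (taddG NK N1 p d) = (if d.1 % 2 = 0 then parityG NK N1 p else !parityG NK N1 p) := by
  obtain ⟨k, i, j⟩ := p
  obtain ⟨dk, di, dj⟩ := d
  simp only [parityG, taddG]
  have hv : (((zmodG NK ((k.val : ℤ) + dk)).val : ℤ)) = ((k.val : ℤ) + dk) % NK := zmodG_val_cast NK _
  -- reduce everything to integer parities
  have h2 : (((zmodG NK ((k.val : ℤ) + dk)).val : ℤ) % 2) = ((k.val : ℤ) + dk) % 2 := by
    rw [hv]
    exact Int.emod_emod_of_dvd _ (by exact_mod_cast hNK)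
  have cast2 : ∀ n : ℕ, (n % 2 == 0) = decide ((n : ℤ) % 2 = 0) := by
    intro n
    have : ((n : ℤ) % 2 = 0) ↔ (n % 2 = 0) := by omega
    by_cases h : n % 2 = 0 <;> simp [h, this]
  rw [cast2, cast2, h2]
  by_cases hk : (k.val : ℤ) % 2 = 0 <;> by_cases hd : dk % 2 = 0 <;> simp [hk, hd] <;> omega

/-! ### The value of the transfer terms of one class -/

/-- The value of a table `X` (upper-triangular entry list) on the elongation list `z`, with a sign/scale `c`. [folklore] -/
def tableVal {n : ℕ} (c : ℚ) (X : List (ℕ × ℕ × ℚ)) (z : List (LinF n)) (u : Fin n → ℚ) : ℚ :=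
  evalQ (X.map fun e => (c * e.2.2 * (if e.1 = e.2.1 then 1 else 2), z.getD e.1 [], z.getD e.2.1 [])) u

/-- `tableVal` is linear in the sign/scale. [folklore] -/
theorem tableVal_neg {n : ℕ} (X : List (ℕ × ℕ × ℚ)) (z : List (LinF n)) (u : Fin n → ℚ) :
    tableVal (-1) X z u = -tableVal 1 X z u := by
  unfold tableVal
  induction X with
  | nil => simp
  | cons e X ih => simp only [List.map_cons, evalQ_cons] at ih ⊢; rw [ih]; ring

/-- **The transfer terms of a class list at `p`, evaluated**: `+X(dl p, dl(p+d))` where `p` has the first parity, `−X(dl(p−d), dl p)` where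
`p` has the partner parity. [folklore] -/
theorem evalQ_transferTermsG (p : SiteG NK N1) (tcls : List (Bool × Off × Bool × Bool × List ℤ)) (u : Fin (dimG NK N1) → ℚ) :
    evalQ (transferTermsG NK N1 p tcls) u =
      (tcls.map fun cl =>
        (if cl.1 == parityG NK N1 p then
            tableVal 1 (tableX cl.2.2.2.1 cl.2.2.2.2) (dlG NK N1 p ++ dlG NK N1 (taddG NK N1 p cl.2.1)) u else 0) +
        (if cl.2.2.1 == parityG NK N1 p then
            tableVal (-1) (tableX cl.2.2.2.1 cl.2.2.2.2) (dlG NK N1 (taddG NK N1 p (negOff cl.2.1)) ++ dlG NK N1 p) u else 0)).sum := by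
  simp only [transferTermsG, evalQ_flatMapN]
  congr 1
  refine List.map_congr_left fun cl _ => ?_
  rw [List.map_append, List.sum_append]
  congr 1
  · split <;> simp [tableVal]
  · split <;> simp [tableVal]

/-! ### Summing over the sites -/

/-- A `Finset` sum of list sums is the list sum of `Finset` sums. [folklore] -/
theorem sum_map_list_comm {ι α : Type*} [Fintype ι] (l : List α) (f : ι → α → ℚ) :
    ∑ p, (l.map (f p)).sum = (l.map fun a => ∑ p, f p a).sum := by
  induction l with
  | nil => simp
  | cons a l ih => simp only [List.map_cons, List.sum_cons, Finset.sum_add_distrib, ih]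

/-- **Table transfers sum to zero over the torus** (even number of layers, consistent classes, ANY tables). [folklore] -/
theorem transfer_siteSum_zero (hNK : 2 ∣ NK) (tcls : List (Bool × Off × Bool × Bool × List ℤ))
    (hwf : ∀ cl ∈ tcls, cl.2.2.1 = (if cl.2.1.1 % 2 = 0 then cl.1 else !cl.1)) (u : Fin (dimG NK N1) → ℚ) :
    ∑ p : SiteG NK N1, evalQ (transferTermsG NK N1 p tcls) u = 0 := by
  simp only [evalQ_transferTermsG, sum_map_list_comm]
  apply List.sum_eq_zero
  intro x hx
  rw [List.mem_map] at hx
  obtain ⟨cl, hcl, rfl⟩ := hx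
  have hc : cl.2.2.1 = (if cl.2.1.1 % 2 = 0 then cl.1 else !cl.1) := hwf cl hcl
  rw [Finset.sum_add_distrib]
  -- reindex the partner sum by the shift `q ↦ q + d`
  have hre : ∑ p : SiteG NK N1, (if cl.2.2.1 == parityG NK N1 p then
        tableVal (-1) (tableX cl.2.2.2.1 cl.2.2.2.2) (dlG NK N1 (taddG NK N1 p (negOff cl.2.1)) ++ dlG NK N1 p) u else 0) =
      ∑ q : SiteG NK N1, (if cl.1 == parityG NK N1 q then
        -tableVal 1 (tableX cl.2.2.2.1 cl.2.2.2.2) (dlG NK N1 q ++ dlG NK N1 (taddG NK N1 q cl.2.1)) u else 0) := by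
    rw [← (shiftEquiv NK N1 cl.2.1).sum_comp]
    refine Finset.sum_congr rfl fun q _ => ?_
    simp only [shiftEquiv, Equiv.coe_fn_mk, taddG_negOff, parityG_taddG NK N1 hNK, hc, tableVal_neg]
    by_cases hd : cl.2.1.1 % 2 = 0 <;> cases cl.1 <;> cases parityG NK N1 q <;> simp [hd]
  rw [hre, ← Finset.sum_add_distrib]
  refine Finset.sum_eq_zero fun q _ => ?_
  split <;> simp

/-- **Weak duality for the certificate's own transfer format with arbitrary tables**: a field with negative site-balance sum defeats
every consistent class list. [folklore] -/
theorem not_jointLMI_tables_of_siteSum_neg (hNK : 2 ∣ NK) (lam : ℚ) (u : Fin (dimG NK N1) → ℚ)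
    (hneg : ∑ p, siteBalance NK N1 lam p u < 0) (tcls : List (Bool × Off × Bool × Bool × List ℤ))
    (hwf : ∀ cl ∈ tcls, cl.2.2.1 = (if cl.2.1.1 % 2 = 0 then cl.1 else !cl.1)) :
    ¬ ∀ (p : SiteG NK N1) (v : Fin (dimG NK N1) → ℚ), lam * kappaS NK N1 p v + readoutS NK N1 p v ≤
        supplyS NK N1 p v + evalQ (transferTermsG NK N1 p tcls) v + meanProjS NK N1 v :=
  not_jointLMI_of_siteSum_neg NK N1 lam u hneg (fun p v => evalQ (transferTermsG NK N1 p tcls) v)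
    (transfer_siteSum_zero NK N1 hNK tcls hwf u)

/-- **No consistent class list of transfer tables rescues the `λ`-scaled sitewise LMI** once a field with negative site-balance sum
exists (any number of classes, any offsets, any table entries). [folklore] -/
theorem not_exists_tables_jointLMI_of_siteSum_neg (hNK : 2 ∣ NK) (lam : ℚ) (u : Fin (dimG NK N1) → ℚ)
    (hneg : ∑ p, siteBalance NK N1 lam p u < 0) :
    ¬ ∃ tcls : List (Bool × Off × Bool × Bool × List ℤ), (∀ cl ∈ tcls, cl.2.2.1 = (if cl.2.1.1 % 2 = 0 then cl.1 else !cl.1)) ∧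
      ∀ (p : SiteG NK N1) (v : Fin (dimG NK N1) → ℚ), lam * kappaS NK N1 p v + readoutS NK N1 p v ≤
        supplyS NK N1 p v + evalQ (transferTermsG NK N1 p tcls) v + meanProjS NK N1 v := by
  rintro ⟨tcls, hwf, h⟩
  exact not_jointLMI_tables_of_siteSum_neg NK N1 hNK lam u hneg tcls hwf h

end Shape

end Summit.AtomisticToContinuum.Crystallization.Theorems.StrictSplittingRuleTorusLMI
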